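import Summits.QuantumFields.BalabanUV.Beta.D1BFx.NeedleNdlDipRow
import Summits.QuantumFields.BalabanUV.Beta.D1BFx.NeedleProjNdlRow

/-!
# `BalabanUV.Beta.D1BFx.NeedleDipNdlRow` — road «BF-x» for binder row D1, slot (K), END row `hGrp gN`, «GN-33 ∕ KN»: THE `dipPiece ⊗ ndlPiece` CELL OF
# THE GLUON NEEDLE ROW T₃ IS n-UNIFORM UNDER THE RAY WEIGHT — `|cK n · cellSum n a (dipPiece n a) (ndlPiece n a (cQ n)) μ ν| ≤ C` for every `n ≥ 1`,
# the hypothesis `hdn` of `GluonNeedleGlue.h₃_of_cells`, modulo [B5, Prop. 1.2] ∧ [B5, (1.126)–(1.127)] BY NAME and the displayed ray pins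
# `|cK n| ≤ cgh·n²`, `|cQ n| ≤ cQ₀` — the `ndl ⊗ dip` word read at `(ν, μ, b, b+w)` by the cyclicity of the trace, the needle at the BASE bond

HONEST DEPENDENCY (cell records, verbatim): «continuum YM on T⁴ ⇐ BetaPertH ∧ nine spine estimates (0/9 proved); BetaPertH ⇐ (D1) ∧ (D4) ∧
CAP+tail; G-an2-4 gates asym, D1 and NE2/3/4.»  HONEST FRAMING (cell contract, verbatim): «discharging `BetaPertH` makes Bałaban's UV stability
UNCONDITIONAL — a real constructive-QFT result; it is NOT the continuum limit and NOT the Clay problem.»  THIS MODULE DISCHARGES NOTHING of the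
wall: [folklore] counting over `NeedleNdlDipEnvelope.exists_word_envelope` (where the two NAMED printed statements enter, BY NAME, through the letters),
leaf-03's `FineHessianSectors.biBubbleTable_transpose` with the owner's `GluonNeedleGlue.exists_biLoc_dipPiece` ∕ `exists_biLoc_ndlPiece`, my
`NeedleProjNdlRow.abs_weight_le_of_mem_B` ∕ `sum_resSite_needle_weight_le` (M7 over the residue sites), `NeedleNdlDipRow.moments_le`,
`GluonNeedleGlue.cellSum_def`, `LatticeHLSPairing.abs_fullSum_le_of_abs_sum_le`.  No `def`, no `def … : Prop`, nothing cited, 0 sorry.  Root-level binders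
hW ∕ hR-sockets ∕ hSX-socket ∕ D1Tel ∕ D1Rep — 0 discharged; (K) NOT closed; NOT D1, NOT `BetaPertH`, NOT continuum, NOT Clay.

ABSOLUTE RULE (cell charter, verbatim): «No internally-minted statement may enter as a cited fact. Every hypothesis is either kernel-proved in
this package or a verbatim quotation of a PUBLISHED theorem with page reference. The manuscript(s) under audit are NOT citable for their own
disputed steps — they are the thing under adjudication; programme-internal (2001/route/tribunal) claims are never citable.»

WHY (owner d1-p2 gen 11 RULING ρ-g11-2 ∕ ρ-g11-3; my statement line l.31599).  COUNT.  `biBubbleTable Ga Ga dip ndl μ ν (b+w) b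
= biBubbleTable Ga Ga ndl dip ν μ b (b+w)`: the needle sits at the BASE bond `(ν, b)`, the dip runs with `w`; the envelope
`Σ_{s∈B(blk b)} |qJet_b s|·G(b+w−s)`, `G(t) = A₁n⁻⁴·e₄(t)∕nrm(t) + A₀n⁻⁵·e₄(t)` (even); the w-sum FIRST: `|w_μw_ν| ≤ 2‖b+w−s‖² + 2n²` (`s` in the
base block), `Σ_w (2‖t‖²+2n²)·G(t) ≤ A₁n⁻⁴·m₁n⁵ + A₀n⁻⁵·m₀n⁶ = n·(A₁m₁ + A₀m₀)` ⇒ `|fullSum_b| ≤ ‖q_b‖₁·n·(A₁m₁+A₀m₀)`; the base average is the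
census: `n⁻⁴·Σ_{b∈resSites} ‖q_b‖₁ ≤ (n−1)·n⁻⁴` (M7) ⇒ `≤ n⁻²·(A₁m₁+A₀m₀)`; `× |cK n| ≤ cgh·n²` ⇒ n⁰.
* §1 [folklore] **`abs_fullSum_le_of_base_needle_envelope`** (generic: a needle-site envelope at the BASE bond, even site function, centred moments).
* §2 [folklore] **`exists_dipNdl_row_le`** = `hdn` of `GluonNeedleGlue.h₃_of_cells` for every `n ≥ 1`.
Unit `b2b-balaban-beta-d1-formalise-leaf-01` (gen 15), D1 formalisation swarm LEAF PROVER 01; `LEAVES-BFx.md` row (N) «GN-33∕KN».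
-/

noncomputable section

namespace Summit.QuantumFields.BalabanUV.Beta.D1BFx.NeedleDipNdlRow

open Finset
open scoped BigOperators
open Literature.MathematicalPhysics.QuantumFieldTheory.Balaban1983to89
open Literature.MathematicalPhysics.QuantumFieldTheory.Balaban1983to89.Beta
open B6QGQLower276 (X e blk B mem_B)
open ExpKernelCalculus (Site MKer bubble)
open DyadicShell (Pt toReal)
open WindowIdentification (fullSum)
open DressedMomentNormalisation (resSite)
open VectorTailsLoc (fam kfam)
open Beta.PoissonInterior (nrm nrm_pos nrm_neg)
open Summit.QuantumFields.BalabanUV.Beta.TameKernelCalculus (Spr)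
open Summit.QuantumFields.BalabanUV.Beta.D1BFx.PackedKernelSplit (biBubble bubble_eq_biBubble)
open Summit.QuantumFields.BalabanUV.Beta.D1BFx.FineHessianSectors (biBubbleTable biBubbleTable_apply biBubbleTable_transpose)
open Summit.QuantumFields.BalabanUV.Beta.D1BFx.GluonLeg (Ga)
open Summit.QuantumFields.BalabanUV.Beta.D1BFx.GluonLegTails (spr_Ga_of_prop12)
open Summit.QuantumFields.BalabanUV.Beta.D1BFx.FrozenLegTails (nOf MOf hn1)
open Summit.QuantumFields.BalabanUV.Beta.D1BFx.GhostStencil (qJet)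
open Summit.QuantumFields.BalabanUV.Beta.D1BFx.GluonNeedleSplit (ndlPiece dipPiece)
open Summit.QuantumFields.BalabanUV.Beta.D1BFx.GluonNeedleGlue (cellSum cellSum_def exists_biLoc_dipPiece exists_biLoc_ndlPiece)
open Summit.QuantumFields.BalabanUV.Beta.D1BFx.NeedleProjNdlRow (abs_weight_le_of_mem_B sum_resSite_needle_weight_le)
open Summit.QuantumFields.BalabanUV.Beta.D1BFx.LatticeHLSPairing (abs_fullSum_le_of_abs_sum_le)
open Summit.QuantumFields.BalabanUV.Beta.D1BFx.NeedleNdlDipEnvelope (exists_word_envelope)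
open Summit.QuantumFields.BalabanUV.Beta.D1BFx.NeedleNdlDipRow (moments_le)

variable (n : ℕ) [NeZero n] (a : ℝ)

/-! ## §1 The (1.22) sum at one base site from a needle-site envelope at the BASE bond -/

/-- [folklore] **THE (1.22) SUM FROM A NEEDLE-SITE ENVELOPE AT THE BASE BOND** (generic): if `|T w| ≤ Σ_{s∈B(blk b)} |qJet_b s|·G(b+w−s)` with `G ≥ 0`
even and `Σ_{w∈S}(2‖c−w‖²+2n²)·G(c−w) ≤ Mg` for every centre `c` and finite `S`, then `|fullSum (w ↦ w_μw_ν·T w)| ≤ (Σ_{s∈B(blk b)} |qJet_b s|)·Mg`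
(`|w_μw_ν| ≤ 2‖b+w−s‖² + 2n²` for `s` in the base block; the w-sum first, per needle site, centred at `s − b`). -/
theorem abs_fullSum_le_of_base_needle_envelope {T G : Pt → ℝ} {Mg : ℝ} (κ : Fin 4) (b : Pt) (hG0 : ∀ t, 0 ≤ G t) (hGev : ∀ t, G (-t) = G t)
    (hT : ∀ w : Pt, |T w| ≤ ∑ s ∈ B (n - 1) (blk (n - 1) b), |qJet n κ b (blk (n - 1) b) s| * G (b + w - s))
    (hmom : ∀ (c : Pt) (S : Finset Pt), ∑ w ∈ S, (2 * (PoissonInterior.supNorm (d := 4) (c - w) : ℝ) ^ 2 + 2 * (n : ℝ) ^ 2) * G (c - w) ≤ Mg)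
    (μ ν : Fin 4) :
    |fullSum (fun w : Pt => toReal w μ * toReal w ν * T w)| ≤ (∑ s ∈ B (n - 1) (blk (n - 1) b), |qJet n κ b (blk (n - 1) b) s|) * Mg := by
  have hMg : 0 ≤ Mg := le_trans (Finset.sum_nonneg fun w _ => mul_nonneg (by positivity) (hG0 _)) (hmom b ∅)
  have hfin : ∀ S : Finset Pt, ∑ w ∈ S, |toReal w μ * toReal w ν * T w| ≤ (∑ s ∈ B (n - 1) (blk (n - 1) b), |qJet n κ b (blk (n - 1) b) s|) * Mg := by
    intro S
    calc ∑ w ∈ S, |toReal w μ * toReal w ν * T w|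
        ≤ ∑ w ∈ S, ∑ s ∈ B (n - 1) (blk (n - 1) b), |toReal w μ * toReal w ν| * (|qJet n κ b (blk (n - 1) b) s| * G (b + w - s)) := by
          refine Finset.sum_le_sum fun w _ => ?_
          rw [abs_mul, ← Finset.mul_sum]
          exact mul_le_mul_of_nonneg_left (hT w) (abs_nonneg _)
      _ = ∑ s ∈ B (n - 1) (blk (n - 1) b), ∑ w ∈ S, |toReal w μ * toReal w ν| * (|qJet n κ b (blk (n - 1) b) s| * G (b + w - s)) := Finset.sum_comm
      _ ≤ ∑ s ∈ B (n - 1) (blk (n - 1) b), ∑ w ∈ S, (2 * (PoissonInterior.supNorm (d := 4) ((s - b) - w) : ℝ) ^ 2 + 2 * (n : ℝ) ^ 2) *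
            (|qJet n κ b (blk (n - 1) b) s| * G ((s - b) - w)) := by
          refine Finset.sum_le_sum fun s hs => Finset.sum_le_sum fun w _ => ?_
          have e1 : b + w - s = -((s - b) - w) := by abel
          have e2 : (PoissonInterior.supNorm (d := 4) (b + w - s) : ℝ) = PoissonInterior.supNorm (d := 4) ((s - b) - w) := by
            rw [e1, PoissonInterior.supNorm_neg]
          rw [e1, hGev, ← e2]
          exact mul_le_mul_of_nonneg_right (abs_weight_le_of_mem_B n b w s hs μ ν) (mul_nonneg (abs_nonneg _) (hG0 _))
      _ = ∑ s ∈ B (n - 1) (blk (n - 1) b), |qJet n κ b (blk (n - 1) b) s| *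
            ∑ w ∈ S, (2 * (PoissonInterior.supNorm (d := 4) ((s - b) - w) : ℝ) ^ 2 + 2 * (n : ℝ) ^ 2) * G ((s - b) - w) := by
          refine Finset.sum_congr rfl fun s _ => ?_
          rw [Finset.mul_sum]; exact Finset.sum_congr rfl fun w _ => by ring
      _ ≤ ∑ s ∈ B (n - 1) (blk (n - 1) b), |qJet n κ b (blk (n - 1) b) s| * Mg :=
          Finset.sum_le_sum fun s _ => mul_le_mul_of_nonneg_left (hmom (s - b) S) (abs_nonneg _)
      _ = _ := by rw [Finset.sum_mul]
  exact (abs_fullSum_le_of_abs_sum_le hfin).2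

/-! ## §2 The cell -/

variable {n} in
/-- [folklore] **«GN-33 ∕ KN»: THE `dipPiece ⊗ ndlPiece` CELL OF T₃ IS n-UNIFORM UNDER THE RAY WEIGHT** — the hypothesis `hdn` of
`GluonNeedleGlue.h₃_of_cells` (there for `n ≥ 2`, a fortiori), modulo [B5, Prop. 1.2] ∧ [B5, (1.126)–(1.127)] BY NAME and the displayed ray pins
`|cK n| ≤ cgh·n²`, `|cQ n| ≤ cQ₀`: one `C ≥ 0` (depending on `a`, `cgh`, `cQ₀`) with `|cK n · cellSum n a (dipPiece n a) (ndlPiece n a (cQ n)) μ ν| ≤ C`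
for every `n ≥ 1`. -/
theorem exists_dipNdl_row_le (ha : 0 < a) (h12 : B5.Prop12Printed (fam nOf hn1 MOf a ha)) (h126 : B5.Kernel126_127Printed (kfam nOf MOf))
    {cK : ℕ → ℝ} {cgh : ℝ} (hcK : ∀ n, |cK n| ≤ cgh * (n : ℝ) ^ 2) {cQ : ℕ → ℝ} {cQ₀ : ℝ} (hcQ : ∀ n, |cQ n| ≤ cQ₀) (μ ν : Fin 4) :
    ∃ C : ℝ, 0 ≤ C ∧ ∀ (n : ℕ) [NeZero n], |cK n * cellSum n a (dipPiece n a) (ndlPiece n a (cQ n)) μ ν| ≤ C := by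
  obtain ⟨δ, A₁, A₀, hδ, hA₁, hA₀, henv⟩ := exists_word_envelope a ha h12 h126 cQ₀
  have hcgh : 0 ≤ cgh := by have h := hcK 1; norm_num at h; exact (abs_nonneg _).trans h
  set m₁ : ℝ := 2 * (2 * (Nat.factorial 2) * (2 / (δ / 4)) ^ 2 * (1 + 2 * (4 : ℕ) * 3 ^ (4 - 1) * ((Nat.factorial (4 - 1 - 1)) * (4 / (δ / 4)) ^ (4 - 1 - 1) * (1 + 4 / (δ / 4)))))
      + 2 * (2 * (Nat.factorial 0) * (2 / (δ / 4)) ^ 0 * (1 + 2 * (4 : ℕ) * 3 ^ (4 - 1) * ((Nat.factorial (4 - 1 - 1)) * (4 / (δ / 4)) ^ (4 - 1 - 1) * (1 + 4 / (δ / 4))))) with hm₁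
  set m₀ : ℝ := 2 * (2 * (Nat.factorial 2) * (2 / (δ / 4)) ^ 2 * (1 + 2 * (4 : ℕ) * 3 ^ (4 - 1) * ((Nat.factorial (4 - 1 - 0)) * (4 / (δ / 4)) ^ (4 - 1 - 0) * (1 + 4 / (δ / 4)))))
      + 2 * (2 * (Nat.factorial 0) * (2 / (δ / 4)) ^ 0 * (1 + 2 * (4 : ℕ) * 3 ^ (4 - 1) * ((Nat.factorial (4 - 1 - 0)) * (4 / (δ / 4)) ^ (4 - 1 - 0) * (1 + 4 / (δ / 4))))) with hm₀
  have hm₁0 : 0 ≤ m₁ := by positivity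
  have hm₀0 : 0 ≤ m₀ := by positivity
  refine ⟨cgh * (A₁ * m₁ + A₀ * m₀), by positivity, fun n _ => ?_⟩
  clear_value m₁ m₀
  have hn : (0 : ℝ) < n := by exact_mod_cast Nat.pos_of_ne_zero (NeZero.ne n)
  have hn1 : (1 : ℝ) ≤ n := by exact_mod_cast NeZero.one_le
  have hA : Spr (Ga n a) := spr_Ga_of_prop12 (a := a) (ha := ha) h12 h126 n
  obtain ⟨Cd, δd, hδd, hSd⟩ := exists_biLoc_dipPiece n a ha
  obtain ⟨Cn, δn, hδn, hSn⟩ := exists_biLoc_ndlPiece n a ha (cQ n)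
  -- the even site function
  set G : Pt → ℝ := fun t => A₁ * ((n : ℝ) ^ 4)⁻¹ * (Real.exp (-(δ / 4 / n) * PoissonInterior.supNorm (d := 4) t) / nrm t ^ 1)
    + A₀ * ((n : ℝ) ^ 5)⁻¹ * (Real.exp (-(δ / 4 / n) * PoissonInterior.supNorm (d := 4) t) / nrm t ^ 0) with hG
  have hG0 : ∀ t, 0 ≤ G t := fun t => by have := nrm_pos t; simp only [hG]; positivity
  have hGev : ∀ t, G (-t) = G t := fun t => by simp only [hG, PoissonInterior.supNorm_neg, nrm_neg]
  -- the word read at `(ν, μ, b, b+w)`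
  have hT : ∀ b w : Pt, |biBubbleTable (Ga n a) (Ga n a) (dipPiece n a) (ndlPiece n a (cQ n)) μ ν (b + w) b|
      ≤ ∑ s ∈ B (n - 1) (blk (n - 1) b), |qJet n ν b (blk (n - 1) b) s| * G (b + w - s) := by
    intro b w
    rw [biBubbleTable_transpose (A := Ga n a) (B := Ga n a) hA hA hSd hδd hSn hδn μ ν (b + w) b]
    refine (henv n (cQ n) (hcQ n) ν μ b (b + w)).trans (le_of_eq (Finset.sum_congr rfl fun s _ => ?_))
    have e1 : s - (b + w) = -(b + w - s) := by abel
    rw [← hGev, ← e1]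
    simp only [hG, pow_one, pow_zero, div_one]
  have hmom : ∀ (c : Pt) (S : Finset Pt), ∑ w ∈ S, (2 * (PoissonInterior.supNorm (d := 4) (c - w) : ℝ) ^ 2 + 2 * (n : ℝ) ^ 2) * G (c - w)
      ≤ A₁ * ((n : ℝ) ^ 4)⁻¹ * (m₁ * (n : ℝ) ^ 5) + A₀ * ((n : ℝ) ^ 5)⁻¹ * (m₀ * (n : ℝ) ^ 6) := by
    intro c S
    obtain ⟨h1, h0⟩ := moments_le (n := n) hδ c S
    rw [← hm₁] at h1; rw [← hm₀] at h0
    calc ∑ w ∈ S, (2 * (PoissonInterior.supNorm (d := 4) (c - w) : ℝ) ^ 2 + 2 * (n : ℝ) ^ 2) * G (c - w)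
        = A₁ * ((n : ℝ) ^ 4)⁻¹ * ∑ w ∈ S, (2 * (PoissonInterior.supNorm (d := 4) (c - w) : ℝ) ^ 2 + 2 * (n : ℝ) ^ 2) *
              (Real.exp (-(δ / 4 / n) * PoissonInterior.supNorm (d := 4) (c - w)) / nrm (c - w) ^ 1)
          + A₀ * ((n : ℝ) ^ 5)⁻¹ * ∑ w ∈ S, (2 * (PoissonInterior.supNorm (d := 4) (c - w) : ℝ) ^ 2 + 2 * (n : ℝ) ^ 2) *
              (Real.exp (-(δ / 4 / n) * PoissonInterior.supNorm (d := 4) (c - w)) / nrm (c - w) ^ 0) := by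
          rw [Finset.mul_sum, Finset.mul_sum, ← Finset.sum_add_distrib]
          exact Finset.sum_congr rfl fun w _ => by simp only [hG]; ring
      _ ≤ _ := add_le_add (mul_le_mul_of_nonneg_left h1 (by positivity)) (mul_le_mul_of_nonneg_left h0 (by positivity))
  have hMg : A₁ * ((n : ℝ) ^ 4)⁻¹ * (m₁ * (n : ℝ) ^ 5) + A₀ * ((n : ℝ) ^ 5)⁻¹ * (m₀ * (n : ℝ) ^ 6) = (n : ℝ) * (A₁ * m₁ + A₀ * m₀) := by
    field_simp
  -- one base site
  have hsite : ∀ b : Pt, |fullSum (fun w : Pt => toReal w μ * toReal w ν *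
      biBubbleTable (Ga n a) (Ga n a) (dipPiece n a) (ndlPiece n a (cQ n)) μ ν (b + w) b)|
      ≤ (∑ s ∈ B (n - 1) (blk (n - 1) b), |qJet n ν b (blk (n - 1) b) s|) * ((n : ℝ) * (A₁ * m₁ + A₀ * m₀)) := by
    intro b
    have h := abs_fullSum_le_of_base_needle_envelope n ν b hG0 hGev (hT b) hmom μ ν
    rwa [hMg] at h
  -- the base average is the census
  rw [cellSum_def, abs_mul]
  have hK0 : 0 ≤ (n : ℝ) * (A₁ * m₁ + A₀ * m₀) := by positivity
  calc |cK n| * |∑ b ∈ (univ : Finset (Fin 4 → Fin n)).image resSite, ((n : ℝ) ^ 4)⁻¹ *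
          fullSum (fun w : Pt => toReal w μ * toReal w ν * biBubbleTable (Ga n a) (Ga n a) (dipPiece n a) (ndlPiece n a (cQ n)) μ ν (b + w) b)|
      ≤ (cgh * (n : ℝ) ^ 2) * ∑ b ∈ (univ : Finset (Fin 4 → Fin n)).image resSite, ((n : ℝ) ^ 4)⁻¹ *
          ((∑ s ∈ B (n - 1) (blk (n - 1) b), |qJet n ν b (blk (n - 1) b) s|) * ((n : ℝ) * (A₁ * m₁ + A₀ * m₀))) := by
        refine mul_le_mul (hcK n) ((Finset.abs_sum_le_sum_abs _ _).trans (Finset.sum_le_sum fun b _ => ?_)) (abs_nonneg _) (by positivity)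
        rw [abs_mul, abs_of_nonneg (by positivity : (0 : ℝ) ≤ ((n : ℝ) ^ 4)⁻¹)]
        exact mul_le_mul_of_nonneg_left (hsite b) (by positivity)
    _ = (cgh * (n : ℝ) ^ 2) * (((n : ℝ) ^ 4)⁻¹ * ((n : ℝ) * (A₁ * m₁ + A₀ * m₀))) *
          ∑ b ∈ (univ : Finset (Fin 4 → Fin n)).image resSite, ∑ s ∈ B (n - 1) (blk (n - 1) b), |qJet n ν b (blk (n - 1) b) s| := by
        rw [Finset.mul_sum, Finset.mul_sum]
        exact Finset.sum_congr rfl fun b _ => by ring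
    _ ≤ (cgh * (n : ℝ) ^ 2) * (((n : ℝ) ^ 4)⁻¹ * ((n : ℝ) * (A₁ * m₁ + A₀ * m₀))) * ((n : ℝ) - 1) :=
        mul_le_mul_of_nonneg_left (sum_resSite_needle_weight_le ν) (by positivity)
    _ ≤ (cgh * (n : ℝ) ^ 2) * (((n : ℝ) ^ 4)⁻¹ * ((n : ℝ) * (A₁ * m₁ + A₀ * m₀))) * n :=
        mul_le_mul_of_nonneg_left (by linarith) (by positivity)
    _ = cgh * (A₁ * m₁ + A₀ * m₀) := by field_simp

/-! ## §3 (v1.1, APPENDED 2026-08-21 for the owner's «GN-WIRE» `GluonNeedleRowT3.h₃_of_prop12'`) The cell in the displayed auxiliary-weight form -/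

variable {n} in
/-- [folklore] **`hKN` OF `GluonNeedleRowT3.h₃_of_prop12'` IN ITS DISPLAYED SHAPE** — the cell at the auxiliary constant weight `cgh₀·n²` (`0 ≤ cgh₀`), modulo
[B5, Prop. 1.2] ∧ [B5, (1.126)–(1.127)] BY NAME and `|cQ n| ≤ cQ₀`: `∃ C ≥ 0, ∀ n [NeZero n], |cgh₀·n²·cellSum n a (dipPiece n a) (ndlPiece n a (cQ n)) μ ν| ≤ C`
(`exists_dipNdl_row_le` at `cK n := cgh₀·n²`, `cgh := cgh₀`). -/
theorem hKN_of_prop12 (ha : 0 < a) (h12 : B5.Prop12Printed (fam nOf hn1 MOf a ha)) (h126 : B5.Kernel126_127Printed (kfam nOf MOf))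
    {cgh₀ : ℝ} (hcgh₀ : 0 ≤ cgh₀) {cQ : ℕ → ℝ} {cQ₀ : ℝ} (hcQ : ∀ n, |cQ n| ≤ cQ₀) (μ ν : Fin 4) :
    ∃ C : ℝ, 0 ≤ C ∧ ∀ (n : ℕ) [NeZero n], |cgh₀ * (n : ℝ) ^ 2 * cellSum n a (dipPiece n a) (ndlPiece n a (cQ n)) μ ν| ≤ C :=
  exists_dipNdl_row_le a ha h12 h126 (cK := fun n => cgh₀ * (n : ℝ) ^ 2) (cgh := cgh₀)
    (fun n => by rw [abs_mul, abs_of_nonneg hcgh₀, abs_pow, Nat.abs_cast]) hcQ μ ν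

end Summit.QuantumFields.BalabanUV.Beta.D1BFx.NeedleDipNdlRow

end
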